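import Literature.NumberTheory.Automorphic.FreitasLeHungSiksekModularity
import Literature.NumberTheory.DiophantineGeometry.BcgpResiduallyA5bModular
import Literature.NumberTheory.Automorphic.IsAutomorphicAE
import HarnessLib

/-!
# Freitas–Le Hung–Siksek 2015, Theorem 1, in abelian-variety / `GL₂` form: one-dimensional
# abelian varieties over real quadratic fields are automorphic

Topic `Literature/NumberTheory/Automorphic`; namespace `Literature.NumberTheory.Automorphic`. ONE
named fact (D-0014), no proof, no new definition: Theorem 1 of N. Freitas, B. V. Le Hung, S. Siksek,
*Elliptic curves over real quadratic fields are modular*, Invent. Math. 201 (2015) 159–206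
(arXiv:1310.7088) — "Let `E` be an elliptic curve over a real quadratic field `K`. Then `E` is
modular." — rendered for ABELIAN VARIETIES OF DIMENSION ONE in the tree's scheme-theoretic model
`Literature.AlgebraicGeometry.Motives.AbelianVariety` and in the summit's almost-everywhere `GL₂`
vocabulary, i.e. with EXACTLY the conclusion clause of the accepted facts
`Literature.NumberTheory.DiophantineGeometry.bcgp_residuallyA5b_modular_abelianSurface` /
`bcgp_switch_exists_modular_abelianSurface` (there: `GL₄`, abelian surfaces over `ℚ`), at `n = 2`
over a real quadratic `K`.

The tree already holds the same theorem in WEIERSTRASS form,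
`Literature.NumberTheory.Automorphic.FreitasLeHungSiksek2015_thm1` (`FreitasLeHungSiksekModularity`:
every integral Weierstrass model with `Δ ≠ 0` over a real quadratic `K` is modular in the
Caraiani–Newton trace sense `IsModularEllipticCurve`). The two renderings are not interderivable in
the tree: `WeierstrassCurve.AbelianVarietyBridge` (`EllipticCurves/AbelianVarietyBridge`) records the
identification "smooth Weierstrass cubic = one-dimensional abelian variety" only as a hypothesis
structure, and no construction `AbelianVariety K → WeierstrassCurve (𝓞 K)` (or back) exists. The
present form is the one consumed by statements typed over `AbelianVariety K` and framed duals of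
rational Tate modules (first consumer: the ladder line `GL2TypeSurfaceRealQuadratic` on
`Summit.Langlands.Langlands.Theses.*.ReciprocityUpToIrreducibility`, whose floor `g = 1` it is).

## Source and reading

Theorem 1 (Introduction), verbatim: "Let `E` be an elliptic curve over a real quadratic field `K`.
Then `E` is modular."  Definition (Introduction, the paragraph before Thm. 1), verbatim: "`E` is
modular if there exists a Hilbert cuspidal eigenform `𝔣` over `K` of parallel weight `2`, with
rational Hecke eigenvalues, such that the Hasse–Weil L-function of `E` is equal to the L-function of
`𝔣`. A more conceptual way to phrase this is that there is an isomorphism of compatible systems of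
Galois representations `ρ_{E,p} ≅ ρ_{𝔣,p}` where the left-hand side is the Galois representation
arising from the action of `G_K` on the `p`-adic Tate module `T_p(E)`, while the right-hand side is
the Galois representation associated to `𝔣` by Eichler and Shimura (when `K = ℚ`), and by Carayol,
Blasius and Rogawski, Wiles and Taylor (for general totally real `K`)."  §2 end / proof of Thm. 1:
the finitely many exceptional `j`-invariants are treated in §§4–5; curves with those `j` over the
relevant fields "have complex multiplication and are therefore modular" (the CM case is INCLUDED in
Theorem 1: over a real field `K` a CM curve has CM field `M ⊄ K`, `ρ_{E,p} = Ind_{KM}^{K} ψ` is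
irreducible and `π = AI(ψ)` is cuspidal).

RENDERING. HYPOTHESES: `K` a real quadratic field = `NumberField.IsTotallyReal K ∧
Module.finrank ℚ K = 2` (as in `FreitasLeHungSiksek2015_thm1`); `A : AbelianVariety K` with
`A.dim = 1` — an abelian variety of dimension one over `K` is an elliptic curve over `K` and
conversely (Silverman, *Advanced Topics*, III §2, Example 2.4.1 and Remark 2.5; Shatz 1986, §2,
pp. 33–34: the smooth plane cubic with the chord–tangent law "is an elliptic curve or abelian
variety of dimension `1`"; the dictionary recalled in `EllipticCurves/AbelianVarietyBridge`); a
prime `ℓ`, a `ℚ_ℓ`-basis `b` of the rational Tate module `V_ℓ(A) = A.rationalTateModule ℓ`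
(`DiophantineGeometry/AVGaloisModule`, with its `Γ_K`-representation `A.rationalTateRep ℓ`), and the
FRAMED DUAL `r : Γ_K → GL₂(ℚ̄_ℓ)` of `V_ℓ(A)` in the dual basis, `r(g) = [g⁻¹]_bᵀ` — the paper's
`ρ_{E,ℓ}` up to duality, i.e. `H¹_ét(A_{K̄}, ℚ_ℓ) ⊗ ℚ̄_ℓ ≅ V_ℓ(A)^∨ ⊗ ℚ̄_ℓ` framed (VERBATIM the
framed-dual clause of the BCGP facts, their §1.8.11). CONCLUSION, the cofinite `GL₂` shadow of
"`L(E, s) = L(𝔣, s)`" in the normalisation the summit statement `Summit.Langlands.Corresponds` /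
`SatakeFrobCompatibleAt` and `IsAutomorphicAE` use (Buzzard–Gee: `L`-algebraic `π`, arithmetic
Frobenius, `arithFrobPolyOfSatake ι q 1 a`, review 13 of `ReciprocityGLn`): given the compactness
input `isCompact_glFiniteIntegralLevel 2 K` that `CuspidalAutomorphicRepData` takes and any
`ι : ℚ̄_ℓ ≃+* ℂ`, there is an `L`-algebraic CUSPIDAL automorphic representation `π` of `GL₂(𝔸_K)`
(the `L`-algebraic twist `π_𝔣 ⊗ |det|^{∓1/2}` of the unitary cuspidal representation generated by
the newform `𝔣`; cuspidal also in the CM case, see above) whose Satake parameters `a_v` satisfy, for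
all but finitely many finite places `v` of `K`: `r` is unramified at `v` and `det(X − r(Frob_v)) =
arithFrobPolyOfSatake ι q_v 1 a_v` (`FramedGaloisRep.IsUnramifiedAt`, `HasFrobCharpolyAt` of
`GaloisRep`). This is the compatible-system isomorphism `ρ_{E,p} ≅ ρ_{𝔣,p}` of the definition read at
the unramified places (Carayol / Blasius–Rogawski / Taylor: `ρ_{𝔣,𝔭}` is unramified outside `𝔭𝔫`
with `tr ρ_{𝔣,𝔭}(Frob_v) = a_v(𝔣)`), on the dual `H¹` exactly as in the `GL₄` facts.

What is deliberately NOT here: the Hilbert eigenform `𝔣` itself, its level (= conductor of `E`) and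
the equality of completed L-functions at the ramified places (the tree's Borel–Jacquet datum model
has Satake parameters at unramified places as its only local vocabulary — the same restriction as
`IsAutomorphicAE`, `bcgp_*`, `ramakrishnan2002_asaiTransfer_GL2`); the rationality of the Hecke
eigenvalues. The proof (modularity lifting over totally real fields for `p = 3, 5, 7` with
Langlands–Tunnell at `3`, `3`–`5` and `3`–`7` modularity switching, Thorne's and Skinner–Wiles'
residually dihedral / reducible theorems, and the determination of the real quadratic points on the
finitely many exceptional modular curves, §§2–5) is a theory absent from Mathlib and the tree.

## References

* [FreitasLeHungSiksek2015] N. Freitas, B. V. Le Hung, S. Siksek, Elliptic curves over real quadratic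
  fields are modular, Invent. Math. 201 (2015), 159–206, arXiv:1310.7088: Thm. 1; Introduction
  (definition of modular, compatible systems); §2 (overview), §§4–5 (exceptional `j`, CM curves).
* [Silverman1994] J. H. Silverman, Advanced Topics in the Arithmetic of Elliptic Curves, GTM 151
  (1994): III §2, Example 2.4.1, Remark 2.5 (elliptic curves = abelian varieties of dimension one).
* [Shatz1986GroupSchemes] S. S. Shatz, Group schemes, formal groups, and `p`-divisible groups, in
  Arithmetic Geometry (Cornell–Silverman eds.), Springer (1986): §2, pp. 33–34.
* [BuzzardGeeLMS2014] K. Buzzard, T. Gee, The conjectural connections between automorphic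
  representations and Galois representations, LMS Lecture Notes 414 (2014): §2.1, Conj. 3.2.1
  (`L`-algebraic normalisation, arithmetic Frobenius).
* [Carayol1986] H. Carayol, Sur les représentations `ℓ`-adiques associées aux formes modulaires de
  Hilbert, Ann. Sci. ÉNS 19 (1986), 409–468: Thm. (A)/(B) (`ρ_{𝔣,λ}`, unramified outside `𝔫λ`,
  `tr ρ(Frob_v) = a_v`).
* [Taylor1989] R. Taylor, On Galois representations associated to Hilbert modular forms, Invent.
  Math. 98 (1989), 265–280: Thm. 1 (even degree).
-/

namespace Literature.NumberTheory.Automorphic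

open CategoryTheory IsDedekindDomain NumberField
open scoped NumberField Matrix
open Literature.NumberTheory.GaloisRepresentations
open Literature.AlgebraicGeometry.Motives (AbelianVariety)

/-- **Freitas–Le Hung–Siksek 2015, Theorem 1** ("Let `E` be an elliptic curve over a real quadratic
field `K`. Then `E` is modular."), abelian-variety / `GL₂` almost-everywhere form. For every real
quadratic field `K` (`IsTotallyReal K`, `[K:ℚ] = 2`), every abelian variety `A/K` of dimension `1`
(= an elliptic curve over `K`: Silverman ATAEC III.2.4.1 / 2.5, Shatz 1986 §2), every prime `ℓ`,
every framed dual `r : Γ_K → GL₂(ℚ̄_ℓ)` of `V_ℓ(A)` in the dual basis of a `ℚ_ℓ`-basis `b`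
(`r(g) = [g⁻¹]_bᵀ`, the paper's `ρ_{E,ℓ}` on `H¹`) and every `ι : ℚ̄_ℓ ≃+* ℂ` (given the compactness
input `isCompact_glFiniteIntegralLevel 2 K`), there is an `L`-algebraic cuspidal automorphic
representation `π` of `GL₂(𝔸_K)` (the `L`-algebraic twist of the parallel-weight-`2` Hilbert newform
`𝔣` with `L(E, s) = L(𝔣, s)`, equivalently `ρ_{E,p} ≅ ρ_{𝔣,p}` as compatible systems — Carayol,
Blasius–Rogawski, Taylor) whose Satake parameters `a_v` satisfy, for all but finitely many `v`:
`r` is unramified at `v` and `det(X − r(Frob_v)) = arithFrobPolyOfSatake ι q_v 1 a_v` (arithmetic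
Frobenius, Buzzard–Gee normalisation; VERBATIM the conclusion clause of
`bcgp_residuallyA5b_modular_abelianSurface` at `n = 2`). CM curves are included (over a real `K` the
CM field is not contained in `K`, so `π = AI(ψ)` is cuspidal; FLS treat them in §§4–5). The same
theorem in Weierstrass / trace form is `FreitasLeHungSiksek2015_thm1`; the two are not interderivable
in the tree (no construction `AbelianVariety K ↔ WeierstrassCurve`, cf.
`WeierstrassCurve.AbelianVarietyBridge`). Users take
`(h : fls2015_modular_abelianVariety_dimOne_realQuadratic)`. Named fact (D-0014), not proved in the
tree.
[cite: FreitasLeHungSiksek2015, Thm. 1 with the Introduction's definition of modular (compatible systems ρ_{E,p} ≅ ρ_{𝔣,p}) and §§4–5 (CM / exceptional j)]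
[cite: Silverman1994, III.2.4.1, III.2.5 (elliptic curves = abelian varieties of dimension one)]
[cite: BuzzardGeeLMS2014, §2.1, Conj. 3.2.1 (L-algebraic normalisation)] -/
def fls2015_modular_abelianVariety_dimOne_realQuadratic : Prop :=
  ∀ (K : Type) [Field K] [NumberField K] [IsTotallyReal K], Module.finrank ℚ K = 2 →
    ∀ (A : AbelianVariety K), A.dim = 1 →
      ∀ (ℓ : ℕ) [Fact ℓ.Prime] (b : Module.Basis (Fin 2) ℚ_[ℓ] (A.rationalTateModule ℓ))
        (r : FramedGaloisRep K (PadicAlgCl ℓ) 2),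
        (∀ g : Field.absoluteGaloisGroup K,
          (r g).val =
            ((LinearMap.toMatrix b b (A.rationalTateRep ℓ g⁻¹)).map
              (algebraMap ℚ_[ℓ] (PadicAlgCl ℓ))).transpose) →
        ∀ (hcpt : isCompact_glFiniteIntegralLevel 2 K) (ι : PadicAlgCl ℓ ≃+* ℂ),
          ∃ π : CuspidalAutomorphicRepData 2 K hcpt, π.1.IsLAlgebraic ∧
            ∀ᶠ v : HeightOneSpectrum (𝓞 K) in Filter.cofinite, ∃ a : Multiset ℂ,
              π.1.HasSatakeParamAt v a ∧ r.IsUnramifiedAt v ∧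
                r.HasFrobCharpolyAt v (arithFrobPolyOfSatake ι v.residueCard 1 a)

end Literature.NumberTheory.Automorphic
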